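import Mathlib
import HarnessLib
import Summits.ResolutionOfSingularities.ResolutionOfSingularities.Theorems.WildQuotientsWildQuotientResolutionS1aBlowupChartNode
import Summits.ResolutionOfSingularities.ResolutionOfSingularities.Theorems.WildQuotientsWildQuotientResolutionS1aAuxCharts

/-!
# S1a — FROM A RING-LEVEL (CENSUS-TYPE) CERTIFICATE TO `AuxOrbitAt`: the single-chart case, end to end

[OURS · L1 W4.5c · lead-1 g9; plan-1 g12 RULING 10:56:19Z (d) «the bridge from census certificates to the A stub»] — NOT statements of the manuscript;
counted 0; AI-level work, weaker than expert review. Crux stmt-ResolutionOfSingularities-17941, line `s1a-logminvertex` v10, registered research stub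
`stub_auxWithinReachAux` (orbit disjunct, attack form `AuxChartsAt`). Route-independent.

What a census certificate IS, in tree vocabulary, at ONE special chart `O` of a model `M` (node `(B, 𝒜, σ, e)`): a FIRST-LEVEL weighted centre `(f, δ, w)`
(K1′-regular, σ-adapted, homogeneous, Veronese degree `d`; `IsCentreChartData`), whose zero set on `O` is CLOSED in `M.V`, lies in the bad locus and contains
a top-dimensional component of `nonKillable M`; a σ-fixed NORMALISED COVER `(k, y_j ∈ K_{dk})`; and on every chart ring `ChartRing 𝒜 f w (dk) y_j` SECOND-LEVEL
ring kill data (`RingKillData`, …S1aBlowupChartNode p628829). This file proves that such a certificate gives `AuxChartsAt M` (…S1aAuxCharts p626350), hence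
`AuxOrbitAt M` on a separated model:
* `NodeAtlas.IsCentreChartData` and ★ `exists_isCentreChart_of_data` (the CENTRE-chart twin of the producer p627540: the chart filtration
  `chartFiltration O ((traceFiltration 𝒜 f w).comap e)` with its pieces on `O` and its support on `O` = the zero set of the trace);
* ★★ `GameFrame.GModel.auxChartsAt_of_ringData` and `auxOrbitAt_of_ringData`.
-/

set_option linter.dupNamespace false

noncomputable section

universe u

open CategoryTheory Limits AlgebraicGeometry TopologicalSpace Topology Opposite
open Literature.AlgebraicGeometry.Resolution Literature.AlgebraicGeometry.RelativeSpec
open Summit.ResolutionOfSingularities.ResolutionOfSingularities.Theorems.WildQuotientResolution.S1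
open Summit.ResolutionOfSingularities.ResolutionOfSingularities.Theorems.WildQuotientResolution.S1.NodeAtlas
open Summit.ResolutionOfSingularities.ResolutionOfSingularities.Theorems.WildQuotientResolution.S1.ProducerStep
open Summit.ResolutionOfSingularities.ResolutionOfSingularities.Theorems.WildQuotientResolution.S1.CoarseChart
open Summit.ResolutionOfSingularities.ResolutionOfSingularities.Theorems.WildQuotientResolution.S1.BlowupCharts
open Summit.ResolutionOfSingularities.ResolutionOfSingularities.Theorems.WildQuotientResolution.S1.ChartData
open Summit.ResolutionOfSingularities.ResolutionOfSingularities.Theorems.WildQuotientResolution.S1.ExtendRees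
open Summit.ResolutionOfSingularities.ResolutionOfSingularities.Theorems.WildQuotientResolution.S1.KillableTransport

/-! ## Centre chart DATA and the centre-chart producer -/

namespace Summit.ResolutionOfSingularities.ResolutionOfSingularities.Theorems.WildQuotientResolution.S1.NodeAtlas

variable (p : ℕ) {V Y : Scheme.{u}} {q : V ⟶ Y} {G : Type*} [Group G] (ρ : ActionOver q G) (g₀ : G)

/-- **CENTRE CHART DATA** on a stable affine open `O` with Veronese degree `d`: the body of `IsCentreChart` with the Rees filtration REMOVED (tame node
presenting `Γ(V, O)` with the `g₀`-intertwining; a K1′-regular σ-adapted homogeneous weighted centre; `d` a Veronese degree). [OURS · L1 W4.5c] -/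
def IsCentreChartData (d : ℕ) (O : ρ.StableAffineOpens) : Prop :=
  ∃ (_ : IsAffineOpen O.1) (m : ℕ) (r : Fin m → ℕ) (B : Type u) (_ : CommRing B)
    (𝒜 : (Π j : Fin m, ZMod (r j)) → AddSubgroup B) (_ : GradedRing 𝒜) (σ : B ≃+* B)
    (e : Γ(V, O.1) ≃+* ↥(𝒜 0)),
    IsTameNode p B 𝒜 σ ∧
    (∀ t : Γ(V, O.1),
      ((e ((ρ.aut g₀⁻¹).hom.appLE O.1 O.1 (O.2.1 g₀⁻¹).ge t) : ↥(𝒜 0)) : B) = σ ((e t : ↥(𝒜 0)) : B)) ∧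
    ∃ (c : ℕ) (f : Fin c → B) (δ : Fin c → Π j : Fin m, ZMod (r j)) (w : Fin c → ℕ),
      0 < c ∧ (∀ i, f i ∈ 𝒜 (δ i)) ∧ (∀ i, 0 < w i) ∧
      RingTheory.Sequence.IsRegular B (List.ofFn f) ∧ IsRegularRing (B ⧸ Ideal.span (Set.range f)) ∧
      (∀ n : ℕ, ((weightedFiltration f w).ideal n).map (σ : B →+* B) ≤ (weightedFiltration f w).ideal n) ∧
      CoarseChart.VeroneseNormalised 𝒜 f w d

end Summit.ResolutionOfSingularities.ResolutionOfSingularities.Theorems.WildQuotientResolution.S1.NodeAtlas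

namespace Summit.ResolutionOfSingularities.ResolutionOfSingularities.Theorems.WildQuotientResolution.S1.ChartData

variable {V : Scheme.{u}} [IsLocallyNoetherian V]

/-- **Support of the chart filtration on its chart** is the zero locus of the given ideal. [OURS · L1 W4.5c] -/
theorem mem_support_chartFiltration_iff (O : V.Opens) (hO : IsAffineOpen O) (K : IdealFiltration Γ(V, O)) (n : ℕ) {v : V} (hv : v ∈ O) :
    v ∈ ((((chartFiltration O K).ideal n).support : Set V)) ↔ v ∈ V.zeroLocus (U := O) (K.ideal n : Set Γ(V, O)) := by
  have h := filtration_chartFiltration O hO K n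
  rw [ReesFiltration.filtration_ideal] at h
  change v ∈ ((chartFiltration O K).ideal n).support ↔ _
  rw [Scheme.IdealSheafData.mem_support_iff_of_mem (U := ⟨O, hO⟩) hv, h]

/-- **Support of the chart filtration** = closure of the zero locus on the chart. [OURS · L1 W4.5c] -/
theorem support_chartFiltration (O : V.Opens) (hO : IsAffineOpen O) (K : IdealFiltration Γ(V, O)) (n : ℕ) :
    ((((chartFiltration O K).ideal n).support : Set V)) = closure (V.zeroLocus (U := O) (K.ideal n : Set Γ(V, O)) ∩ (O : Set V)) := by
  rw [chartFiltration, support_pushforwardRees]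
  congr 1
  ext x
  constructor
  · rintro ⟨u, hu, rfl⟩
    refine ⟨?_, u.2⟩
    have := (mem_support_chartFiltration_iff O hO K n u.2).mp ?_
    · exact this
    · rw [chartFiltration, support_pushforwardRees]
      exact subset_closure ⟨u, hu, rfl⟩
  · rintro ⟨hx, hxO⟩
    refine ⟨⟨x, hxO⟩, ?_, rfl⟩
    have h1 : x ∈ ((((chartFiltration O K).ideal n).support : Set V)) := (mem_support_chartFiltration_iff O hO K n hxO).mpr hx
    rw [chartFiltration, pushforwardRees_ideal, Scheme.IdealSheafData.support_map] at h1
    -- `x ∈ closure (ι '' S)` with `x ∈ O`: pull back along the open immersion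
    let S : Set (O : Scheme.{u}) := ((((ofTop (K.map (O.ι.appLE O ⊤ O.ι_preimage_self.ge).hom)).ideal n).support : Set (O : Scheme.{u})))
    have hopen : IsOpenEmbedding (O.ι.base) := O.ι.isOpenEmbedding
    have h2 : (⟨x, hxO⟩ : (O : Scheme.{u})) ∈ O.ι.base ⁻¹' closure (O.ι.base '' S) := h1
    have h3 := hopen.isOpenMap.preimage_closure_subset_closure_preimage h2
    rw [Set.preimage_image_eq _ hopen.injective] at h3
    rwa [(((ofTop (K.map (O.ι.appLE O ⊤ O.ι_preimage_self.ge).hom)).ideal n).support).isClosed.closure_eq] at h3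

end Summit.ResolutionOfSingularities.ResolutionOfSingularities.Theorems.WildQuotientResolution.S1.ChartData

namespace Summit.ResolutionOfSingularities.ResolutionOfSingularities.Theorems.WildQuotientResolution.S1.NodeAtlas

open ChartData

variable {p : ℕ} {V Y : Scheme.{u}} {q : V ⟶ Y} {G : Type*} [Group G] {ρ : ActionOver q G} {g₀ : G}

/-- ★ **THE CENTRE-CHART PRODUCER**: centre chart DATA on `O` give the Rees filtration `chartFiltration O ((trace).comap e)` for which `O` IS a centre chart,
with its pieces on `O` equal to the traces and its support = the closure of the zero set of the degree-`d` trace on `O`. [OURS · L1 W4.5c] -/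
theorem exists_isCentreChart_of_data [IsLocallyNoetherian V] {d : ℕ} {O : ρ.StableAffineOpens} (h : IsCentreChartData p ρ g₀ d O) :
    ∃ (𝒦 : ReesFiltration V) (hO : IsAffineOpen O.1), IsCentreChart p ρ g₀ 𝒦 d O ∧
      ∃ (m : ℕ) (r : Fin m → ℕ) (B : Type u) (_ : CommRing B) (𝒜 : (Π j : Fin m, ZMod (r j)) → AddSubgroup B) (_ : GradedRing 𝒜) (σ : B ≃+* B)
        (e : Γ(V, O.1) ≃+* ↥(𝒜 0)) (c : ℕ) (f : Fin c → B) (δ : Fin c → Π j : Fin m, ZMod (r j)) (w : Fin c → ℕ),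
        IsTameNode p B 𝒜 σ ∧
        (∀ t : Γ(V, O.1), ((e ((ρ.aut g₀⁻¹).hom.appLE O.1 O.1 (O.2.1 g₀⁻¹).ge t) : ↥(𝒜 0)) : B) = σ ((e t : ↥(𝒜 0)) : B)) ∧
        (∀ i, f i ∈ 𝒜 (δ i)) ∧ (∀ i, 0 < w i) ∧ RingTheory.Sequence.IsRegular B (List.ofFn f) ∧ IsRegularRing (B ⧸ Ideal.span (Set.range f)) ∧
        (∀ n : ℕ, ((weightedFiltration f w).ideal n).map (σ : B →+* B) ≤ (weightedFiltration f w).ideal n) ∧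
        CoarseChart.VeroneseNormalised 𝒜 f w d ∧
        (∀ n : ℕ, (𝒦.filtration ⟨O.1, hO⟩).ideal n = ((traceFiltration 𝒜 f w).ideal n).comap (e : Γ(V, O.1) →+* ↥(𝒜 0))) ∧
        ∀ n : ℕ, (((𝒦.ideal n).support : Set V)) =
          closure (V.zeroLocus (U := O.1) ((((traceFiltration 𝒜 f w).ideal n).comap (e : Γ(V, O.1) →+* ↥(𝒜 0)) : Ideal Γ(V, O.1)) : Set Γ(V, O.1))
            ∩ (O.1 : Set V)) := by
  obtain ⟨hO, m, r, B, _, 𝒜, _, σ, e, hnode, hσ, c, f, δ, w, hc, hf, hw, hK1, hK1', hσJ, hver⟩ := h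
  let K : IdealFiltration Γ(V, O.1) := (CoarseChart.traceFiltration 𝒜 f w).comap (e : Γ(V, O.1) →+* ↥(𝒜 0))
  refine ⟨chartFiltration O.1 K, hO, ⟨hO, m, r, B, inferInstance, 𝒜, inferInstance, σ, e, hnode, hσ, c, f, δ, w, hc, hf, hw, hK1, hK1', hσJ,
    fun n => ?_, hver⟩, m, r, B, inferInstance, 𝒜, inferInstance, σ, e, c, f, δ, w, hnode, hσ, hf, hw, hK1, hK1', hσJ, hver, fun n => ?_, fun n => ?_⟩
  · rw [filtration_chartFiltration O.1 hO K n]; rfl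
  · rw [filtration_chartFiltration O.1 hO K n]; rfl
  · rw [support_chartFiltration O.1 hO K n]; rfl

end Summit.ResolutionOfSingularities.ResolutionOfSingularities.Theorems.WildQuotientResolution.S1.NodeAtlas

/-! ## The single-chart certificate ⇒ `AuxChartsAt` ⇒ `AuxOrbitAt` -/

namespace Summit.ResolutionOfSingularities.ResolutionOfSingularities.Theorems.WildQuotientResolution.S1.GameFrame.GModel

variable {p : ℕ} {X' X₁ : Scheme.{0}} {q : X' ⟶ X₁} {G : Type} [Group G] {ρ : G →* Aut X'} {g₀ : G}

/-- ★★ **A SINGLE-CHART RING CERTIFICATE GIVES `AuxChartsAt`.** On a model `M` (`G = ⟨g₀⟩` finite, `p` prime; no base hypothesis needed): a stable affine open `O` with EXPLICIT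
node `(B, 𝒜, σ, e)` (tame; `hσp`; intertwining `g₀`) and FIRST-LEVEL centre `(f, δ, w)` of Veronese degree `d` (K1′-regular, σ-adapted, homogeneous),
whose degree-`d` trace has a zero set `Z₀` on `O` that is CLOSED in `M.V`, lies in `Z(M)` and contains a top-dimensional component of `nonKillable M`;
a σ-fixed cover `(k, y)` of `K_{dk}` generating up to radical; and SECOND-LEVEL `RingKillData` on every chart ring. Then `M.AuxChartsAt`.
[OURS · L1 W4.5c] -/
theorem auxChartsAt_of_ringData [Finite G] (hp : p.Prime) (hG : ∀ g : G, g ∈ Subgroup.zpowers g₀) (M : GModel p q G ρ g₀)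
    (O : M.act.StableAffineOpens) (hO : IsAffineOpen O.1)
    {m : ℕ} (r : Fin m → ℕ) {B : Type} [CommRing B] (𝒜 : (Π j : Fin m, ZMod (r j)) → AddSubgroup B) [GradedRing 𝒜] (σ : B ≃+* B)
    (e : Γ(M.V, O.1) ≃+* ↥(𝒜 0)) (htame : IsTameNode p B 𝒜 σ) (hσp : ∀ x : B, (⇑σ)^[p] x = x)
    (hσ : ∀ t : Γ(M.V, O.1), ((e ((M.act.aut g₀⁻¹).hom.appLE O.1 O.1 (O.2.1 g₀⁻¹).ge t) : ↥(𝒜 0)) : B) = σ ((e t : ↥(𝒜 0)) : B))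
    {c : ℕ} (f : Fin c → B) {δ : Fin c → Π j : Fin m, ZMod (r j)} (w : Fin c → ℕ) (hc : 0 < c) (hf : ∀ i, f i ∈ 𝒜 (δ i)) (hw : ∀ i, 0 < w i)
    (hK1 : RingTheory.Sequence.IsRegular B (List.ofFn f)) (hK1' : IsRegularRing (B ⧸ Ideal.span (Set.range f)))
    (hσJ : ∀ n : ℕ, ((weightedFiltration f w).ideal n).map (σ : B →+* B) ≤ (weightedFiltration f w).ideal n)
    {d : ℕ} (hver : VeroneseNormalised 𝒜 f w d)
    (hZcl : IsClosed (M.V.zeroLocus (U := O.1) ((((traceFiltration 𝒜 f w).ideal d).comap (e : Γ(M.V, O.1) →+* ↥(𝒜 0)) : Ideal Γ(M.V, O.1)) :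
      Set Γ(M.V, O.1)) ∩ (O.1 : Set M.V)))
    (hZbad : M.V.zeroLocus (U := O.1) ((((traceFiltration 𝒜 f w).ideal d).comap (e : Γ(M.V, O.1) →+* ↥(𝒜 0)) : Ideal Γ(M.V, O.1)) :
      Set Γ(M.V, O.1)) ∩ (O.1 : Set M.V) ⊆ M.badLocus)
    (htop : ∃ t ∈ irreducibleComponents ↥M.nonKillable, topologicalKrullDim ↥t = M.jInf ∧
      Subtype.val '' t ⊆ M.V.zeroLocus (U := O.1) ((((traceFiltration 𝒜 f w).ideal d).comap (e : Γ(M.V, O.1) →+* ↥(𝒜 0)) : Ideal Γ(M.V, O.1)) :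
        Set Γ(M.V, O.1)) ∩ (O.1 : Set M.V))
    {k : ℕ} (hk0 : k ≠ 0) {L : ℕ} (y : Fin L → ↥(𝒜 0)) (hy : ∀ j, y j ∈ (traceFiltration 𝒜 f w).ideal (d * k))
    (hσy : ∀ j, σ (y j : B) = y j)
    (hrad : ∀ i : Fin c, cobordantAlgebra.u' f w i ∈ (Ideal.span (Set.range fun j => coverElement 𝒜 f w (d * k) (y j) (hy j))).radical)
    (hdata : ∀ j : Fin L, letI := chartNodeGradedRing r 𝒜 f w hf (d * k) (y j) (hy j)
      RingKillData p (Fin.cons 0 r : Fin (m + 1) → ℕ) (ChartRing 𝒜 f w (d * k) (y j) (hy j)) (chartNodeGrading r 𝒜 f w hf (d * k) (y j) (hy j))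
        (sigmaChart 𝒜 f w (d * k) (y j) (hy j) σ hσJ hp.pos hσp (hσy j))) :
    M.AuxChartsAt := by
  haveI : IsLocallyNoetherian M.V := M.isLocallyNoetherian
  -- the first-level centre chart from the data
  obtain ⟨𝒦, hO', hcentre, -⟩ := NodeAtlas.exists_isCentreChart_of_data (p := p) (ρ := M.act) (g₀ := g₀) (d := d) (O := O)
    ⟨hO, m, r, B, inferInstance, 𝒜, inferInstance, σ, e, htame, hσ, c, f, δ, w, hc, hf, hw, hK1, hK1', hσJ, hver⟩
  -- we use the concrete filtration: redo the construction to keep its formulas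
  let K : IdealFiltration Γ(M.V, O.1) := (traceFiltration 𝒜 f w).comap (e : Γ(M.V, O.1) →+* ↥(𝒜 0))
  let 𝒦₀ : ReesFiltration M.V := chartFiltration O.1 K
  have h𝒦₀O : ∀ n, (𝒦₀.filtration ⟨O.1, hO⟩).ideal n = ((traceFiltration 𝒜 f w).ideal n).comap (e : Γ(M.V, O.1) →+* ↥(𝒜 0)) := fun n =>
    filtration_chartFiltration O.1 hO K n
  have hcentre₀ : IsCentreChart p M.act g₀ 𝒦₀ d O :=
    ⟨hO, m, r, B, inferInstance, 𝒜, inferInstance, σ, e, htame, hσ, c, f, δ, w, hc, hf, hw, hK1, hK1', hσJ, h𝒦₀O, hver⟩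
  -- the hypotheses, restated for the filtration `K`
  have hZcl' : IsClosed (M.V.zeroLocus (U := O.1) (K.ideal d : Set Γ(M.V, O.1)) ∩ (O.1 : Set M.V)) := hZcl
  have hZbad' : M.V.zeroLocus (U := O.1) (K.ideal d : Set Γ(M.V, O.1)) ∩ (O.1 : Set M.V) ⊆ M.badLocus := hZbad
  have hsupp : (((𝒦₀.ideal d).support : Set M.V)) = M.V.zeroLocus (U := O.1) (K.ideal d : Set Γ(M.V, O.1)) ∩ (O.1 : Set M.V) := by
    rw [support_chartFiltration O.1 hO K d, hZcl'.closure_eq]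
  have hsuppO : (((𝒦₀.ideal d).support : Set M.V)) ∩ (O.1 : Set M.V) = M.V.zeroLocus (U := O.1) (K.ideal d : Set Γ(M.V, O.1)) ∩ (O.1 : Set M.V) := by
    rw [hsupp, Set.inter_assoc, Set.inter_self]
  refine ⟨1, fun _ => O, fun _ => 𝒦₀, d, hver.1, fun _ => hcentre₀, fun _ _ U _ _ n => rfl, fun _ => ?_, fun _ => ?_, ?_, ?_⟩
  · -- the chart covers the closure of its support
    rw [hsuppO, hZcl'.closure_eq]
    exact Set.inter_subset_right.trans (Set.subset_iUnion (fun _ : Fin 1 => ((O.1 : Set M.V))) 0)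
  · rw [hsuppO]; exact hZbad'
  · obtain ⟨t, ht, hdt, hts⟩ := htop
    refine ⟨t, ht, hdt, fun x hx => Set.mem_iUnion.mpr ⟨0, ?_⟩⟩
    change x ∈ (((𝒦₀.ideal d).support : Set M.V)) ∩ (O.1 : Set M.V)
    rw [hsuppO]
    exact hts hx
  · -- killability over the support of ANY agreeing `G`-stable extension, for every move
    intro J hJG hJagree hJsupp M' π' hbl hπ hr hcomm v' hv' hvs
    have hJO : ∀ n : ℕ, (J.filtration ⟨O.1, hO⟩).ideal n = ((traceFiltration 𝒜 f w).ideal n).comap (e : Γ(M.V, O.1) →+* ↥(𝒜 0)) := fun n => by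
      rw [hJagree 0 hO n]; exact h𝒦₀O n
    have hvO : π'.base v' ∈ O.1 := by
      have := hJsupp hvs
      obtain ⟨i, hi⟩ := Set.mem_iUnion.mp this
      exact hi
    exact killableAt_over_of_ringKillData hp.pos hG M M' J d (fun g => hJG g d) π' hbl hr hcomm O hO r 𝒜 σ e htame hσp hσ f w hf hw hK1 hK1' hσJ
      hJO hver hk0 y hy hσy hrad hdata v' hvO

/-- ★★ **… HENCE `AuxOrbitAt`** on a separated model (every model of a datum is separated, `isSeparated_of_datum`). [OURS · L1 W4.5c] -/
theorem auxOrbitAt_of_auxChartsAt_of_separated [Finite G] (hG : ∀ g : G, g ∈ Subgroup.zpowers g₀) (M : GModel p q G ρ g₀) [M.V.IsSeparated]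
    (h : M.AuxChartsAt) : M.AuxOrbitAt :=
  AuxCharts.Model.auxOrbitAt_of_auxChartsAt hG M h

end Summit.ResolutionOfSingularities.ResolutionOfSingularities.Theorems.WildQuotientResolution.S1.GameFrame.GModel

end
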